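import Summits.CriticalPhenomena.SAWScalingLimit.Theses.SAWEdwardsStrongCoupling
import Literature.Probability.RandomPlanarGeometry.WeaklySAW
import Literature.Probability.RandomPlanarGeometry.SAWScalingLimitFamily
import Literature.Probability.RandomPlanarGeometry.ConformalRestrictionProofs
import HarnessLib.Audit

/-!
# Crux `CovarianceOfLimit` (stmt-CriticalPhenomena-4649) — birth skeleton `Lines/birth.lean`

Route `route-CriticalPhenomena-SAWEdwardsStrongCoupling` (`CriticalPhenomena/SAWScalingLimit`), crux of
rank 2, concluded BY NAME by `CovarianceOfLimit_of` below:
`Summit.CriticalPhenomena.SAWScalingLimit.Theses.SAWEdwardsStrongCoupling.CovarianceOfLimit` —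
for every Edwards-window limit family `Q` (lattice-characterised: `Q g D` is the weak limit as `δ → 0⁺`
of the critical Domb–Joyce chordal laws `WL (min 1 (g δ²))` in `(Ω_δ; a_δ, b_δ)`) and every chordal `P`
with the restriction property, carried by simple curves meeting `∂D` only at the marked points, with
`Q g D → P D` weakly as `g → ∞` on approximable domains: `P.IsConformallyCovariant`.

## The line = the route's own foreseen split (header, TWO-LAYER PLAN:
`CovarianceOfLimit ⇐ ProfileWindowLimit → ExactProfileCovariance → ProfileUniversality`), typed

The mechanism of the route ("inhomogeneous-coupling Edwards models form a conformally CLOSED class: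
pushing forward along `φ : D → D′` turns the coupling `g` into the PROFILE `g|ψ′|²`, `ψ = φ⁻¹`, with
pointwise-critical fugacity") is made kernel-checkable by INLINING, next to the route's homogeneous law
`WL` (its `let w; let WL` header verbatim), the coupling-PROFILE critical Domb–Joyce chordal law

  `WP g ρ Ω δ a b` := normalised `Σ_p [∏_{s<|p|} μ_{c(z_s)}⁻¹ · ∏_{s<t} (1 − c(z_s)·1{p_s = p_t})] δ_{polyline p}`,
  local coupling `c(z) = min 1 (g δ² ρ(z))` at the mesh point `z_s = δ·p_s`, pointwise-critical fugacity
  `1/μ_{c(z)}` (`μ_λ = WeaklySAW.weaklyConnectiveConstant 2 λ`, tree vocabulary, fact-free),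

with the LOG-HARMONIC profile `ρ_φ(z) = |ψ′(z)|² = ‖deriv φ.symm z‖²` of a conformal equivalence
`φ : D → D′` of Dobrushin domains (boundary values `a ↦ a′`, `b ↦ b′`). At `ρ ≡ 1`, `WP g 1 = WL (min 1 (g δ²))`
definitionally up to unfolding `weaklyConnectiveConstant` (not used below). Three registered stubs, each a
genuine statement of the line over TREE VOCABULARY ONLY (so each lands as a `Theorems/… --supports
stmt-CriticalPhenomena-4649` file without importing this workfile):

* `stub_profileWindowLimit` — (PW) EXISTENCE OF PROFILE WINDOW LIMITS, conditional on the homogeneous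
  ones: if `Q` is an Edwards-window limit family (the crux's own hypothesis `HQ`), then for every `g > 0` and
  every conformal equivalence `φ : D → D′` with boundary values at the marked points, the `ρ_φ`-profile window
  laws in `D′` converge weakly as `δ → 0⁺`, along EVERY endpoint approximation of `D′`, to one law `R`.
  An inhomogeneous Stoll-type invariance principle (tightness of pointwise-critical tilted excursions; the
  profile is unbounded / degenerate at rough prime ends — the crux's declared failure mode no. 1 lives here).
  Sources: Stoll1989; Varadhan1969; LeGall1994; KemppainenSmirnov2017 (arXiv:1212.6215) Thm 1.5.
* `stub_exactProfileCovariance` — (EC) EXACT CONFORMAL COVARIANCE INSIDE THE INHOMOGENEOUS CLASS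
  (identification): any such profile window limit `R` in `D′` IS the conformal image `(Q g D).map (CurveClass.map Φ)`
  of the coupling-`g` window limit in `D` (`Φ` continuous, `Φ = φ` on `D`). The continuum identity
  `φ_* M_c(D; g) = M_c(D′; g|ψ′|²)` (`δ(φx−φy) = δ(x−y)/|φ′|²`, `dτ′ = |φ′|² dτ`, Varadhan counterterm
  transporting `θ_c(g)` to `θ_c(g|ψ′|²)`) read through the lattice characterisations — the crux's declared
  failure mode no. 2 ("the log counterterm could leave a marginal memory of the profile") lives here.
  Sources: LawlerSchrammWerner2004SAW (arXiv:math/0204277) §2; Varadhan1969; LeGall1994 p.172 (1)–(3);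
  Literature.Barriers.CriticalPhenomena.ScaleCovarianceNotMoebius.
* `stub_profileUniversality` — (PU) PROFILE UNIVERSALITY AT STRONG COUPLING: under the crux's hypotheses
  on `(Q, P)`, every family `g ↦ R g` of `ρ_φ`-profile window limits in `D′` converges as `g → ∞` to the SAME
  strong-coupling limit `P D′` ("the bare coupling profile is forgotten at the strong-coupling fixed point";
  only log-harmonic profiles are asserted). Sources: MadrasSlade1993 §10.1; denHollander2009 §4.8 (4);
  BDGS2012 §1.5.2; LawlerSchrammWerner2003Restriction §1.

`CovarianceOfLimit_of (hPW) (hEC) (hPU) : …CovarianceOfLimit` is PROVED below (no `sorry` of its own):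
fix `D D′ φ Φ`; choose the profile limits `R g` (PW), identify `R g = Φ_*(Q g D)` (EC), so
`∫ f d(R g) = ∫ (f ∘ Φ_*) d(Q g D) → ∫ (f ∘ Φ_*) d(P D)` by the crux hypothesis on `D` (an endpoint
approximation of `D` exists, `SAW.exists_isEndpointApprox`; `CurveClass.continuous_map Φ`), while
`∫ f d(R g) → ∫ f d(P D′)` by (PU); limits along `atTop` are unique and finite Borel measures on the
metric space `CurveClass ℂ` are determined by bounded continuous integrals
(`ext_of_forall_integral_eq_of_IsFiniteMeasure`), whence `P D′ = Φ_* (P D)`.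
Logical position of the pieces: EC′ := "Φ_*(Q g D) is the profile window limit" gives PW ∧ EC, and
crux ∧ EC′ ⇒ PU; so the split is PW (lattice tightness) + EC (continuum identity) + PU (RG irrelevance).

Sorries: exactly 3 = the three `stub_*`; zero elsewhere. Disproof used: none (no `Disproof.lean`, no
workfile on this crux before this one). Negatives honoured: none of the 11 refuted statements of the summit
concerns window/profile laws; stmt-0772 (non-eventual `IsTightLaws`) is not used — every `δ`-clause is a
`TendstoLaw` along `𝓝[>] 0`. BC3 probes (planner folder `bc/probe_<stub>_{crux,summit}.lean`): for each
stub `S`, `S → CovarianceOfLimit` and `S → SAWScalingLimit` by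
`first | exact? | simpa [S] | (unfold S; simpa) | aesop` FAIL (see `Lines/birth.md`).
-/

noncomputable section

open MeasureTheory Filter Topology Set Function
open Literature.Probability.RandomPlanarGeometry Literature.Probability.LatticeModels
open scoped ENNReal NNReal BoundedContinuousFunction Topology

namespace Summit.CriticalPhenomena.SAWScalingLimit.Cruxes.CovarianceOfLimit.Birth

/-! ## The three statements of the line, named (bodies = the stub signatures verbatim) -/

/-- **(PW) Profile window limits exist** (conditional on the homogeneous Edwards-window limits `HQ`):
for `g > 0` and a conformal equivalence `φ : D → D′` of Dobrushin domains with boundary values at the marked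
points, the critical Domb–Joyce chordal laws in `D′_δ` with coupling PROFILE `min 1 (g δ² |ψ′(z)|²)`,
`ψ = φ⁻¹`, and pointwise-critical fugacity converge weakly as `δ → 0⁺` to one law `R`, along every endpoint
approximation of `D′`. -/
def ProfileWindowLimit : Prop :=
  let w : ℝ → (G : SimpleGraph (Literature.Probability.LatticeModels.Site 2)) → (u v : Literature.Probability.LatticeModels.Site 2) → G.Walk u v → ℝ := fun lam _G _u _v p => ∏ s ∈ Finset.range (p.length + 1), ∏ t ∈ Finset.Ioc s p.length, (1 - lam * if p.getVert s = p.getVert t then 1 else 0); let WL : ℝ → Set ℂ → ℝ → Literature.Probability.LatticeModels.Site 2 → Literature.Probability.LatticeModels.Site 2 → MeasureTheory.Measure (Literature.Probability.RandomPlanarGeometry.CurveClass ℂ) := fun lam Ω δ a b => (fun S : MeasureTheory.Measure (Literature.Probability.RandomPlanarGeometry.CurveClass ℂ) => (S Set.univ)⁻¹ • S) (MeasureTheory.Measure.sum fun p : (Literature.Probability.LatticeModels.discreteDomainGraph Ω δ).Walk a b => ENNReal.ofReal ((⨅ n : ℕ, (∑ x ∈ Literature.Probability.LatticeModels.box 2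 (n + 1), ∑ q ∈ (Literature.Probability.LatticeModels.zdGraph 2).finsetWalkLength (n + 1) (0 : Literature.Probability.LatticeModels.Site 2) x, w lam (Literature.Probability.LatticeModels.zdGraph 2) 0 x q) ^ (1 / ((n : ℝ) + 1)))⁻¹ ^ p.length * w lam (Literature.Probability.LatticeModels.discreteDomainGraph Ω δ) a b p) • MeasureTheory.Measure.dirac (Literature.Probability.RandomPlanarGeometry.CurveClass.mk ⟨p.toCurve (Literature.Probability.LatticeModels.meshPoint δ)⟩)); let WP : ℝ → (ℂ → ℝ) → Set ℂ → ℝ → Literature.Probability.LatticeModels.Site 2 → Literature.Probability.LatticeModels.Site 2 → MeasureTheory.Measure (Literature.Probability.RandomPlanarGeometry.CurveClass ℂ) := fun g ρ Ω δ a b => (fun S : MeasureTheory.Measure (Literature.Probability.RandomPlanarGeometry.CurveClass ℂ) => (S Set.univ)⁻¹ • S) (MeasureTheory.Measure.sum fun p : (Literature.Probability.LatticeModels.discreteDomainGraph Ω δ).Walk a b => ENNReal.ofReal ((∏ s ∈ Finset.range p.length, (Literature.Probability.RandomPlanarGeometry.WeaklySAW.weaklyConnectiveConstant 2 (min 1 (g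 * δ ^ 2 * ρ (Literature.Probability.LatticeModels.meshPoint δ (p.getVert s)))))⁻¹) * ∏ s ∈ Finset.range (p.length + 1), ∏ t ∈ Finset.Ioc s p.length, (1 - min 1 (g * δ ^ 2 * ρ (Literature.Probability.LatticeModels.meshPoint δ (p.getVert s))) * if p.getVert s = p.getVert t then 1 else 0)) • MeasureTheory.Measure.dirac (Literature.Probability.RandomPlanarGeometry.CurveClass.mk ⟨p.toCurve (Literature.Probability.LatticeModels.meshPoint δ)⟩)); ∀ Q : ℝ → Literature.Probability.RandomPlanarGeometry.ChordalFamily, (∀ g : ℝ, 0 < g → (Q g).IsChordal ∧ ∀ (D : Literature.Probability.RandomPlanarGeometry.DobrushinDomain) (a b : ℝ → Literature.Probability.LatticeModels.Site 2), Literature.Probability.RandomPlanarGeometry.SAW.IsEndpointApprox D a b → Literature.Probability.RandomPlanarGeometry.TendstoLaw (fun (_ : ℝ) (x : Literature.Probability.RandomPlanarGeometry.CurveClass ℂ) => x) (fun δ => WL (min 1 (g * δ ^ 2)) D.carrier δ (a δ) (b δ)) id (Q g D)) → ∀ g : ℝ, 0 < g → ∀ (D D' : Literature.Probability.RandomPlanarGeometry.DobrushinDomain)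 (φ : Literature.Probability.RandomPlanarGeometry.ConformalEquiv D.carrier D'.carrier), φ.HasBoundaryValue (D.pt 0) (D'.pt 0) → φ.HasBoundaryValue (D.pt 1) (D'.pt 1) → ∃ R : MeasureTheory.Measure (Literature.Probability.RandomPlanarGeometry.CurveClass ℂ), ∀ (a' b' : ℝ → Literature.Probability.LatticeModels.Site 2), Literature.Probability.RandomPlanarGeometry.SAW.IsEndpointApprox D' a' b' → Literature.Probability.RandomPlanarGeometry.TendstoLaw (fun (_ : ℝ) (x : Literature.Probability.RandomPlanarGeometry.CurveClass ℂ) => x) (fun δ => WP g (fun z : ℂ => ‖deriv (fun x : ℂ => φ.symm x) z‖ ^ 2) D'.carrier δ (a' δ) (b' δ)) id (R)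

/-- **(EC) Exact covariance inside the inhomogeneous class**: every profile window limit `R` in `D′` (as in
(PW)) equals the conformal image `(Q g D).map (CurveClass.map Φ)` of the coupling-`g` Edwards-window limit in
`D`, for every continuous `Φ : ℂ → ℂ` agreeing with `φ` on `D`. -/
def ExactProfileCovariance : Prop :=
  let w : ℝ → (G : SimpleGraph (Literature.Probability.LatticeModels.Site 2)) → (u v : Literature.Probability.LatticeModels.Site 2) → G.Walk u v → ℝ := fun lam _G _u _v p => ∏ s ∈ Finset.range (p.length + 1), ∏ t ∈ Finset.Ioc s p.length, (1 - lam * if p.getVert s = p.getVert t then 1 else 0); let WL : ℝ → Set ℂ → ℝ → Literature.Probability.LatticeModels.Site 2 → Literature.Probability.LatticeModels.Site 2 → MeasureTheory.Measure (Literature.Probability.RandomPlanarGeometry.CurveClass ℂ) := fun lam Ω δ a b => (fun S : MeasureTheory.Measure (Literature.Probability.RandomPlanarGeometry.CurveClass ℂ) => (S Set.univ)⁻¹ • S) (MeasureTheory.Measure.sum fun p : (Literature.Probability.LatticeModels.discreteDomainGraph Ω δ).Walk a b => ENNReal.ofReal ((⨅ n : ℕ, (∑ x ∈ Literature.Probability.LatticeModels.box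 2 (n + 1), ∑ q ∈ (Literature.Probability.LatticeModels.zdGraph 2).finsetWalkLength (n + 1) (0 : Literature.Probability.LatticeModels.Site 2) x, w lam (Literature.Probability.LatticeModels.zdGraph 2) 0 x q) ^ (1 / ((n : ℝ) + 1)))⁻¹ ^ p.length * w lam (Literature.Probability.LatticeModels.discreteDomainGraph Ω δ) a b p) • MeasureTheory.Measure.dirac (Literature.Probability.RandomPlanarGeometry.CurveClass.mk ⟨p.toCurve (Literature.Probability.LatticeModels.meshPoint δ)⟩)); let WP : ℝ → (ℂ → ℝ) → Set ℂ → ℝ → Literature.Probability.LatticeModels.Site 2 → Literature.Probability.LatticeModels.Site 2 → MeasureTheory.Measure (Literature.Probability.RandomPlanarGeometry.CurveClass ℂ) := fun g ρ Ω δ a b => (fun S : MeasureTheory.Measure (Literature.Probability.RandomPlanarGeometry.CurveClass ℂ) => (S Set.univ)⁻¹ • S) (MeasureTheory.Measure.sum fun p : (Literature.Probability.LatticeModels.discreteDomainGraph Ω δ).Walk a b => ENNReal.ofReal ((∏ s ∈ Finset.range p.length, (Literature.Probability.RandomPlanarGeometry.WeaklySAW.weaklyConnectiveConstant 2 (min 1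 (g * δ ^ 2 * ρ (Literature.Probability.LatticeModels.meshPoint δ (p.getVert s)))))⁻¹) * ∏ s ∈ Finset.range (p.length + 1), ∏ t ∈ Finset.Ioc s p.length, (1 - min 1 (g * δ ^ 2 * ρ (Literature.Probability.LatticeModels.meshPoint δ (p.getVert s))) * if p.getVert s = p.getVert t then 1 else 0)) • MeasureTheory.Measure.dirac (Literature.Probability.RandomPlanarGeometry.CurveClass.mk ⟨p.toCurve (Literature.Probability.LatticeModels.meshPoint δ)⟩)); ∀ Q : ℝ → Literature.Probability.RandomPlanarGeometry.ChordalFamily, (∀ g : ℝ, 0 < g → (Q g).IsChordal ∧ ∀ (D : Literature.Probability.RandomPlanarGeometry.DobrushinDomain) (a b : ℝ → Literature.Probability.LatticeModels.Site 2), Literature.Probability.RandomPlanarGeometry.SAW.IsEndpointApprox D a b → Literature.Probability.RandomPlanarGeometry.TendstoLaw (fun (_ : ℝ) (x : Literature.Probability.RandomPlanarGeometry.CurveClass ℂ) => x) (fun δ => WL (min 1 (g * δ ^ 2)) D.carrier δ (a δ) (b δ)) id (Q g D)) → ∀ g : ℝ, 0 < g → ∀ (D D' : Literature.Probability.RandomPlanarGeometry.DobrushinDomain)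 (φ : Literature.Probability.RandomPlanarGeometry.ConformalEquiv D.carrier D'.carrier) (Φ : C(ℂ, ℂ)), φ.HasBoundaryValue (D.pt 0) (D'.pt 0) → φ.HasBoundaryValue (D.pt 1) (D'.pt 1) → Set.EqOn Φ φ D.carrier → ∀ R : MeasureTheory.Measure (Literature.Probability.RandomPlanarGeometry.CurveClass ℂ), (∀ (a' b' : ℝ → Literature.Probability.LatticeModels.Site 2), Literature.Probability.RandomPlanarGeometry.SAW.IsEndpointApprox D' a' b' → Literature.Probability.RandomPlanarGeometry.TendstoLaw (fun (_ : ℝ) (x : Literature.Probability.RandomPlanarGeometry.CurveClass ℂ) => x) (fun δ => WP g (fun z : ℂ => ‖deriv (fun x : ℂ => φ.symm x) z‖ ^ 2) D'.carrier δ (a' δ) (b' δ)) id (R)) → R = (Q g D).map (Literature.Probability.RandomPlanarGeometry.CurveClass.map Φ)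

/-- **(PU) Profile universality at strong coupling**: under the crux's hypotheses on `(Q, P)`, every family
`g ↦ R g` of `|ψ′|²`-profile window limits in `D′` converges weakly, as `g → ∞`, to the same strong-coupling
limit `P D′` as the homogeneous family. -/
def ProfileUniversality : Prop :=
  let w : ℝ → (G : SimpleGraph (Literature.Probability.LatticeModels.Site 2)) → (u v : Literature.Probability.LatticeModels.Site 2) → G.Walk u v → ℝ := fun lam _G _u _v p => ∏ s ∈ Finset.range (p.length + 1), ∏ t ∈ Finset.Ioc s p.length, (1 - lam * if p.getVert s = p.getVert t then 1 else 0); let WL : ℝ → Set ℂ → ℝ → Literature.Probability.LatticeModels.Site 2 → Literature.Probability.LatticeModels.Site 2 → MeasureTheory.Measure (Literature.Probability.RandomPlanarGeometry.CurveClass ℂ) := fun lam Ω δ a b => (fun S : MeasureTheory.Measure (Literature.Probability.RandomPlanarGeometry.CurveClass ℂ) => (S Set.univ)⁻¹ • S) (MeasureTheory.Measure.sum fun p : (Literature.Probability.LatticeModels.discreteDomainGraph Ω δ).Walk a b => ENNReal.ofReal ((⨅ n : ℕ, (∑ x ∈ Literature.Probability.LatticeModels.box 2 (n + 1), ∑ q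 ∈ (Literature.Probability.LatticeModels.zdGraph 2).finsetWalkLength (n + 1) (0 : Literature.Probability.LatticeModels.Site 2) x, w lam (Literature.Probability.LatticeModels.zdGraph 2) 0 x q) ^ (1 / ((n : ℝ) + 1)))⁻¹ ^ p.length * w lam (Literature.Probability.LatticeModels.discreteDomainGraph Ω δ) a b p) • MeasureTheory.Measure.dirac (Literature.Probability.RandomPlanarGeometry.CurveClass.mk ⟨p.toCurve (Literature.Probability.LatticeModels.meshPoint δ)⟩)); let WP : ℝ → (ℂ → ℝ) → Set ℂ → ℝ → Literature.Probability.LatticeModels.Site 2 → Literature.Probability.LatticeModels.Site 2 → MeasureTheory.Measure (Literature.Probability.RandomPlanarGeometry.CurveClass ℂ) := fun g ρ Ω δ a b => (fun S : MeasureTheory.Measure (Literature.Probability.RandomPlanarGeometry.CurveClass ℂ) => (S Set.univ)⁻¹ • S) (MeasureTheory.Measure.sum fun p : (Literature.Probability.LatticeModels.discreteDomainGraph Ω δ).Walk a b => ENNReal.ofReal ((∏ s ∈ Finset.range p.length, (Literature.Probability.RandomPlanarGeometry.WeaklySAW.weaklyConnectiveConstant 2 (min 1 (g * δ ^ 2 *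 ρ (Literature.Probability.LatticeModels.meshPoint δ (p.getVert s)))))⁻¹) * ∏ s ∈ Finset.range (p.length + 1), ∏ t ∈ Finset.Ioc s p.length, (1 - min 1 (g * δ ^ 2 * ρ (Literature.Probability.LatticeModels.meshPoint δ (p.getVert s))) * if p.getVert s = p.getVert t then 1 else 0)) • MeasureTheory.Measure.dirac (Literature.Probability.RandomPlanarGeometry.CurveClass.mk ⟨p.toCurve (Literature.Probability.LatticeModels.meshPoint δ)⟩)); ∀ (Q : ℝ → Literature.Probability.RandomPlanarGeometry.ChordalFamily) (P : Literature.Probability.RandomPlanarGeometry.ChordalFamily), (∀ g : ℝ, 0 < g → (Q g).IsChordal ∧ ∀ (D : Literature.Probability.RandomPlanarGeometry.DobrushinDomain) (a b : ℝ → Literature.Probability.LatticeModels.Site 2), Literature.Probability.RandomPlanarGeometry.SAW.IsEndpointApprox D a b → Literature.Probability.RandomPlanarGeometry.TendstoLaw (fun (_ : ℝ) (x : Literature.Probability.RandomPlanarGeometry.CurveClass ℂ) => x) (fun δ => WL (min 1 (g * δ ^ 2)) D.carrier δ (a δ) (b δ)) id (Q g D)) → P.IsChordal → P.IsRestriction →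 (∀ D : Literature.Probability.RandomPlanarGeometry.DobrushinDomain, ∀ᵐ γ ∂(P D), γ ∈ Literature.Probability.RandomPlanarGeometry.CurveClass.simple ∧ γ.range ∩ frontier D.carrier ⊆ {D.pt 0, D.pt 1}) → (∀ (D : Literature.Probability.RandomPlanarGeometry.DobrushinDomain) (a b : ℝ → Literature.Probability.LatticeModels.Site 2), Literature.Probability.RandomPlanarGeometry.SAW.IsEndpointApprox D a b → ∀ f : BoundedContinuousFunction (Literature.Probability.RandomPlanarGeometry.CurveClass ℂ) ℝ, Filter.Tendsto (fun g : ℝ => ∫ x, f x ∂(Q g D)) Filter.atTop (nhds (∫ x, f x ∂(P D)))) → ∀ (D D' : Literature.Probability.RandomPlanarGeometry.DobrushinDomain) (φ : Literature.Probability.RandomPlanarGeometry.ConformalEquiv D.carrier D'.carrier), φ.HasBoundaryValue (D.pt 0) (D'.pt 0) → φ.HasBoundaryValue (D.pt 1) (D'.pt 1) → ∀ R : ℝ → MeasureTheory.Measure (Literature.Probability.RandomPlanarGeometry.CurveClass ℂ), (∀ g : ℝ, 0 < g → ∀ (a' b' : ℝ → Literature.Probability.LatticeModels.Site 2), Literature.Probability.RandomPlanarGeometry.SAW.IsEndpointApprox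 D' a' b' → Literature.Probability.RandomPlanarGeometry.TendstoLaw (fun (_ : ℝ) (x : Literature.Probability.RandomPlanarGeometry.CurveClass ℂ) => x) (fun δ => WP g (fun z : ℂ => ‖deriv (fun x : ℂ => φ.symm x) z‖ ^ 2) D'.carrier δ (a' δ) (b' δ)) id (R g)) → ∀ f : BoundedContinuousFunction (Literature.Probability.RandomPlanarGeometry.CurveClass ℂ) ℝ, Filter.Tendsto (fun g : ℝ => ∫ x, f x ∂(R g)) Filter.atTop (nhds (∫ x, f x ∂(P D')))

/-! ## The stubs (the ONLY `sorry`s of the file), stated over tree vocabulary only -/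

/-- Stub PW = `ProfileWindowLimit` verbatim (existence of the log-harmonic-profile window limits, given `HQ`).
Sources: Stoll1989; Varadhan1969; LeGall1994; KemppainenSmirnov2017 Thm 1.5. -/
theorem stub_profileWindowLimit :
    let w : ℝ → (G : SimpleGraph (Literature.Probability.LatticeModels.Site 2)) → (u v : Literature.Probability.LatticeModels.Site 2) → G.Walk u v → ℝ := fun lam _G _u _v p => ∏ s ∈ Finset.range (p.length + 1), ∏ t ∈ Finset.Ioc s p.length, (1 - lam * if p.getVert s = p.getVert t then 1 else 0); let WL : ℝ → Set ℂ → ℝ → Literature.Probability.LatticeModels.Site 2 → Literature.Probability.LatticeModels.Site 2 → MeasureTheory.Measure (Literature.Probability.RandomPlanarGeometry.CurveClass ℂ) := fun lam Ω δ a b => (fun S : MeasureTheory.Measure (Literature.Probability.RandomPlanarGeometry.CurveClass ℂ) => (S Set.univ)⁻¹ • S) (MeasureTheory.Measure.sum fun p : (Literature.Probability.LatticeModels.discreteDomainGraph Ω δ).Walk a b => ENNReal.ofReal ((⨅ n : ℕ, (∑ x ∈ Literature.Probability.LatticeModels.box 2 (n + 1), ∑ q ∈ (Literature.Probability.LatticeModels.zdGraph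 2).finsetWalkLength (n + 1) (0 : Literature.Probability.LatticeModels.Site 2) x, w lam (Literature.Probability.LatticeModels.zdGraph 2) 0 x q) ^ (1 / ((n : ℝ) + 1)))⁻¹ ^ p.length * w lam (Literature.Probability.LatticeModels.discreteDomainGraph Ω δ) a b p) • MeasureTheory.Measure.dirac (Literature.Probability.RandomPlanarGeometry.CurveClass.mk ⟨p.toCurve (Literature.Probability.LatticeModels.meshPoint δ)⟩)); let WP : ℝ → (ℂ → ℝ) → Set ℂ → ℝ → Literature.Probability.LatticeModels.Site 2 → Literature.Probability.LatticeModels.Site 2 → MeasureTheory.Measure (Literature.Probability.RandomPlanarGeometry.CurveClass ℂ) := fun g ρ Ω δ a b => (fun S : MeasureTheory.Measure (Literature.Probability.RandomPlanarGeometry.CurveClass ℂ) => (S Set.univ)⁻¹ • S) (MeasureTheory.Measure.sum fun p : (Literature.Probability.LatticeModels.discreteDomainGraph Ω δ).Walk a b => ENNReal.ofReal ((∏ s ∈ Finset.range p.length, (Literature.Probability.RandomPlanarGeometry.WeaklySAW.weaklyConnectiveConstant 2 (min 1 (g * δ ^ 2 * ρ (Literature.Probability.LatticeModels.meshPoint δ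 (p.getVert s)))))⁻¹) * ∏ s ∈ Finset.range (p.length + 1), ∏ t ∈ Finset.Ioc s p.length, (1 - min 1 (g * δ ^ 2 * ρ (Literature.Probability.LatticeModels.meshPoint δ (p.getVert s))) * if p.getVert s = p.getVert t then 1 else 0)) • MeasureTheory.Measure.dirac (Literature.Probability.RandomPlanarGeometry.CurveClass.mk ⟨p.toCurve (Literature.Probability.LatticeModels.meshPoint δ)⟩)); ∀ Q : ℝ → Literature.Probability.RandomPlanarGeometry.ChordalFamily, (∀ g : ℝ, 0 < g → (Q g).IsChordal ∧ ∀ (D : Literature.Probability.RandomPlanarGeometry.DobrushinDomain) (a b : ℝ → Literature.Probability.LatticeModels.Site 2), Literature.Probability.RandomPlanarGeometry.SAW.IsEndpointApprox D a b → Literature.Probability.RandomPlanarGeometry.TendstoLaw (fun (_ : ℝ) (x : Literature.Probability.RandomPlanarGeometry.CurveClass ℂ) => x) (fun δ => WL (min 1 (g * δ ^ 2)) D.carrier δ (a δ) (b δ)) id (Q g D)) → ∀ g : ℝ, 0 < g → ∀ (D D' : Literature.Probability.RandomPlanarGeometry.DobrushinDomain) (φ : Literature.Probability.RandomPlanarGeometry.ConformalEquiv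 D.carrier D'.carrier), φ.HasBoundaryValue (D.pt 0) (D'.pt 0) → φ.HasBoundaryValue (D.pt 1) (D'.pt 1) → ∃ R : MeasureTheory.Measure (Literature.Probability.RandomPlanarGeometry.CurveClass ℂ), ∀ (a' b' : ℝ → Literature.Probability.LatticeModels.Site 2), Literature.Probability.RandomPlanarGeometry.SAW.IsEndpointApprox D' a' b' → Literature.Probability.RandomPlanarGeometry.TendstoLaw (fun (_ : ℝ) (x : Literature.Probability.RandomPlanarGeometry.CurveClass ℂ) => x) (fun δ => WP g (fun z : ℂ => ‖deriv (fun x : ℂ => φ.symm x) z‖ ^ 2) D'.carrier δ (a' δ) (b' δ)) id (R) := by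
  sorry

/-- Stub EC = `ExactProfileCovariance` verbatim (the conformally-closed-class identity, lattice-characterised).
Sources: LawlerSchrammWerner2004SAW §2; Varadhan1969; LeGall1994 p.172 (1)–(3). -/
theorem stub_exactProfileCovariance :
    let w : ℝ → (G : SimpleGraph (Literature.Probability.LatticeModels.Site 2)) → (u v : Literature.Probability.LatticeModels.Site 2) → G.Walk u v → ℝ := fun lam _G _u _v p => ∏ s ∈ Finset.range (p.length + 1), ∏ t ∈ Finset.Ioc s p.length, (1 - lam * if p.getVert s = p.getVert t then 1 else 0); let WL : ℝ → Set ℂ → ℝ → Literature.Probability.LatticeModels.Site 2 → Literature.Probability.LatticeModels.Site 2 → MeasureTheory.Measure (Literature.Probability.RandomPlanarGeometry.CurveClass ℂ) := fun lam Ω δ a b => (fun S : MeasureTheory.Measure (Literature.Probability.RandomPlanarGeometry.CurveClass ℂ) => (S Set.univ)⁻¹ • S) (MeasureTheory.Measure.sum fun p : (Literature.Probability.LatticeModels.discreteDomainGraph Ω δ).Walk a b => ENNReal.ofReal ((⨅ n : ℕ, (∑ x ∈ Literature.Probability.LatticeModels.box 2 (n + 1), ∑ q ∈ (Literature.Probability.LatticeModels.zdGraph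 2).finsetWalkLength (n + 1) (0 : Literature.Probability.LatticeModels.Site 2) x, w lam (Literature.Probability.LatticeModels.zdGraph 2) 0 x q) ^ (1 / ((n : ℝ) + 1)))⁻¹ ^ p.length * w lam (Literature.Probability.LatticeModels.discreteDomainGraph Ω δ) a b p) • MeasureTheory.Measure.dirac (Literature.Probability.RandomPlanarGeometry.CurveClass.mk ⟨p.toCurve (Literature.Probability.LatticeModels.meshPoint δ)⟩)); let WP : ℝ → (ℂ → ℝ) → Set ℂ → ℝ → Literature.Probability.LatticeModels.Site 2 → Literature.Probability.LatticeModels.Site 2 → MeasureTheory.Measure (Literature.Probability.RandomPlanarGeometry.CurveClass ℂ) := fun g ρ Ω δ a b => (fun S : MeasureTheory.Measure (Literature.Probability.RandomPlanarGeometry.CurveClass ℂ) => (S Set.univ)⁻¹ • S) (MeasureTheory.Measure.sum fun p : (Literature.Probability.LatticeModels.discreteDomainGraph Ω δ).Walk a b => ENNReal.ofReal ((∏ s ∈ Finset.range p.length, (Literature.Probability.RandomPlanarGeometry.WeaklySAW.weaklyConnectiveConstant 2 (min 1 (g * δ ^ 2 * ρ (Literature.Probability.LatticeModels.meshPoint δ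 (p.getVert s)))))⁻¹) * ∏ s ∈ Finset.range (p.length + 1), ∏ t ∈ Finset.Ioc s p.length, (1 - min 1 (g * δ ^ 2 * ρ (Literature.Probability.LatticeModels.meshPoint δ (p.getVert s))) * if p.getVert s = p.getVert t then 1 else 0)) • MeasureTheory.Measure.dirac (Literature.Probability.RandomPlanarGeometry.CurveClass.mk ⟨p.toCurve (Literature.Probability.LatticeModels.meshPoint δ)⟩)); ∀ Q : ℝ → Literature.Probability.RandomPlanarGeometry.ChordalFamily, (∀ g : ℝ, 0 < g → (Q g).IsChordal ∧ ∀ (D : Literature.Probability.RandomPlanarGeometry.DobrushinDomain) (a b : ℝ → Literature.Probability.LatticeModels.Site 2), Literature.Probability.RandomPlanarGeometry.SAW.IsEndpointApprox D a b → Literature.Probability.RandomPlanarGeometry.TendstoLaw (fun (_ : ℝ) (x : Literature.Probability.RandomPlanarGeometry.CurveClass ℂ) => x) (fun δ => WL (min 1 (g * δ ^ 2)) D.carrier δ (a δ) (b δ)) id (Q g D)) → ∀ g : ℝ, 0 < g → ∀ (D D' : Literature.Probability.RandomPlanarGeometry.DobrushinDomain) (φ : Literature.Probability.RandomPlanarGeometry.ConformalEquiv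 D.carrier D'.carrier) (Φ : C(ℂ, ℂ)), φ.HasBoundaryValue (D.pt 0) (D'.pt 0) → φ.HasBoundaryValue (D.pt 1) (D'.pt 1) → Set.EqOn Φ φ D.carrier → ∀ R : MeasureTheory.Measure (Literature.Probability.RandomPlanarGeometry.CurveClass ℂ), (∀ (a' b' : ℝ → Literature.Probability.LatticeModels.Site 2), Literature.Probability.RandomPlanarGeometry.SAW.IsEndpointApprox D' a' b' → Literature.Probability.RandomPlanarGeometry.TendstoLaw (fun (_ : ℝ) (x : Literature.Probability.RandomPlanarGeometry.CurveClass ℂ) => x) (fun δ => WP g (fun z : ℂ => ‖deriv (fun x : ℂ => φ.symm x) z‖ ^ 2) D'.carrier δ (a' δ) (b' δ)) id (R)) → R = (Q g D).map (Literature.Probability.RandomPlanarGeometry.CurveClass.map Φ) := by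
  sorry

/-- Stub PU = `ProfileUniversality` verbatim (the profile is forgotten at the strong-coupling fixed point).
Sources: MadrasSlade1993 §10.1; denHollander2009 §4.8 (4); BDGS2012 §1.5.2. -/
theorem stub_profileUniversality :
    let w : ℝ → (G : SimpleGraph (Literature.Probability.LatticeModels.Site 2)) → (u v : Literature.Probability.LatticeModels.Site 2) → G.Walk u v → ℝ := fun lam _G _u _v p => ∏ s ∈ Finset.range (p.length + 1), ∏ t ∈ Finset.Ioc s p.length, (1 - lam * if p.getVert s = p.getVert t then 1 else 0); let WL : ℝ → Set ℂ → ℝ → Literature.Probability.LatticeModels.Site 2 → Literature.Probability.LatticeModels.Site 2 → MeasureTheory.Measure (Literature.Probability.RandomPlanarGeometry.CurveClass ℂ) := fun lam Ω δ a b => (fun S : MeasureTheory.Measure (Literature.Probability.RandomPlanarGeometry.CurveClass ℂ) => (S Set.univ)⁻¹ • S) (MeasureTheory.Measure.sum fun p : (Literature.Probability.LatticeModels.discreteDomainGraph Ω δ).Walk a b => ENNReal.ofReal ((⨅ n : ℕ, (∑ x ∈ Literature.Probability.LatticeModels.box 2 (n + 1), ∑ q ∈ (Literature.Probability.LatticeModels.zdGraph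 2).finsetWalkLength (n + 1) (0 : Literature.Probability.LatticeModels.Site 2) x, w lam (Literature.Probability.LatticeModels.zdGraph 2) 0 x q) ^ (1 / ((n : ℝ) + 1)))⁻¹ ^ p.length * w lam (Literature.Probability.LatticeModels.discreteDomainGraph Ω δ) a b p) • MeasureTheory.Measure.dirac (Literature.Probability.RandomPlanarGeometry.CurveClass.mk ⟨p.toCurve (Literature.Probability.LatticeModels.meshPoint δ)⟩)); let WP : ℝ → (ℂ → ℝ) → Set ℂ → ℝ → Literature.Probability.LatticeModels.Site 2 → Literature.Probability.LatticeModels.Site 2 → MeasureTheory.Measure (Literature.Probability.RandomPlanarGeometry.CurveClass ℂ) := fun g ρ Ω δ a b => (fun S : MeasureTheory.Measure (Literature.Probability.RandomPlanarGeometry.CurveClass ℂ) => (S Set.univ)⁻¹ • S) (MeasureTheory.Measure.sum fun p : (Literature.Probability.LatticeModels.discreteDomainGraph Ω δ).Walk a b => ENNReal.ofReal ((∏ s ∈ Finset.range p.length, (Literature.Probability.RandomPlanarGeometry.WeaklySAW.weaklyConnectiveConstant 2 (min 1 (g * δ ^ 2 * ρ (Literature.Probability.LatticeModels.meshPoint δ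 (p.getVert s)))))⁻¹) * ∏ s ∈ Finset.range (p.length + 1), ∏ t ∈ Finset.Ioc s p.length, (1 - min 1 (g * δ ^ 2 * ρ (Literature.Probability.LatticeModels.meshPoint δ (p.getVert s))) * if p.getVert s = p.getVert t then 1 else 0)) • MeasureTheory.Measure.dirac (Literature.Probability.RandomPlanarGeometry.CurveClass.mk ⟨p.toCurve (Literature.Probability.LatticeModels.meshPoint δ)⟩)); ∀ (Q : ℝ → Literature.Probability.RandomPlanarGeometry.ChordalFamily) (P : Literature.Probability.RandomPlanarGeometry.ChordalFamily), (∀ g : ℝ, 0 < g → (Q g).IsChordal ∧ ∀ (D : Literature.Probability.RandomPlanarGeometry.DobrushinDomain) (a b : ℝ → Literature.Probability.LatticeModels.Site 2), Literature.Probability.RandomPlanarGeometry.SAW.IsEndpointApprox D a b → Literature.Probability.RandomPlanarGeometry.TendstoLaw (fun (_ : ℝ) (x : Literature.Probability.RandomPlanarGeometry.CurveClass ℂ) => x) (fun δ => WL (min 1 (g * δ ^ 2)) D.carrier δ (a δ) (b δ)) id (Q g D)) → P.IsChordal → P.IsRestriction → (∀ D : Literature.Probability.RandomPlanarGeometry.DobrushinDomain,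 ∀ᵐ γ ∂(P D), γ ∈ Literature.Probability.RandomPlanarGeometry.CurveClass.simple ∧ γ.range ∩ frontier D.carrier ⊆ {D.pt 0, D.pt 1}) → (∀ (D : Literature.Probability.RandomPlanarGeometry.DobrushinDomain) (a b : ℝ → Literature.Probability.LatticeModels.Site 2), Literature.Probability.RandomPlanarGeometry.SAW.IsEndpointApprox D a b → ∀ f : BoundedContinuousFunction (Literature.Probability.RandomPlanarGeometry.CurveClass ℂ) ℝ, Filter.Tendsto (fun g : ℝ => ∫ x, f x ∂(Q g D)) Filter.atTop (nhds (∫ x, f x ∂(P D)))) → ∀ (D D' : Literature.Probability.RandomPlanarGeometry.DobrushinDomain) (φ : Literature.Probability.RandomPlanarGeometry.ConformalEquiv D.carrier D'.carrier), φ.HasBoundaryValue (D.pt 0) (D'.pt 0) → φ.HasBoundaryValue (D.pt 1) (D'.pt 1) → ∀ R : ℝ → MeasureTheory.Measure (Literature.Probability.RandomPlanarGeometry.CurveClass ℂ), (∀ g : ℝ, 0 < g → ∀ (a' b' : ℝ → Literature.Probability.LatticeModels.Site 2), Literature.Probability.RandomPlanarGeometry.SAW.IsEndpointApprox D' a' b'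 → Literature.Probability.RandomPlanarGeometry.TendstoLaw (fun (_ : ℝ) (x : Literature.Probability.RandomPlanarGeometry.CurveClass ℂ) => x) (fun δ => WP g (fun z : ℂ => ‖deriv (fun x : ℂ => φ.symm x) z‖ ^ 2) D'.carrier δ (a' δ) (b' δ)) id (R g)) → ∀ f : BoundedContinuousFunction (Literature.Probability.RandomPlanarGeometry.CurveClass ℂ) ℝ, Filter.Tendsto (fun g : ℝ => ∫ x, f x ∂(R g)) Filter.atTop (nhds (∫ x, f x ∂(P D'))) := by
  sorry

/-! ## Registered names of the stub statements

The skeleton audit admits as hypotheses of `CovarianceOfLimit_of` only propositions whose head constant is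
NAMED like a declared stub, so each statement gets a reducible alias carrying its stub's name. -/
namespace Registered

/-- `ProfileWindowLimit`, under the name of its stub. -/
abbrev stub_profileWindowLimit : Prop := ProfileWindowLimit
/-- `ExactProfileCovariance`, under the name of its stub. -/
abbrev stub_exactProfileCovariance : Prop := ExactProfileCovariance
/-- `ProfileUniversality`, under the name of its stub. -/
abbrev stub_profileUniversality : Prop := ProfileUniversality

end Registered

/-! ## The skeleton theorem: (PW) → (EC) → (PU) → the crux, BY NAME -/

/-- **`CovarianceOfLimit` from the line `birth`** (kernel-checked, no `sorry` of its own). Fix the data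
`Q, P` of the crux and a conformal equivalence `φ : D → D′` with continuous plane extension `Φ`; both
`P D′` and `Φ_* (P D)` are probability measures on the metric (hence `HasOuterApproxClosed`) Borel space
`CurveClass ℂ`, so it suffices to match their integrals of bounded continuous `f`. Choose the profile window
limits `R g` on `D′` (PW); by (EC) `R g = Φ_* (Q g D)` for `g > 0`, so `∫ f d(R g) = ∫ (f ∘ Φ_*) d(Q g D)`,
which tends to `∫ (f ∘ Φ_*) d(P D) = ∫ f d(Φ_* (P D))` by the crux hypothesis `Q g D → P D` (run along an
endpoint approximation of `D`, which exists); by (PU) the same integrals tend to `∫ f d(P D′)`; limits along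
`atTop` are unique. [cite: LawlerSchrammWerner2004SAW, §2] -/
theorem CovarianceOfLimit_of (hPW : Registered.stub_profileWindowLimit)
    (hEC : Registered.stub_exactProfileCovariance) (hPU : Registered.stub_profileUniversality) :
    Summit.CriticalPhenomena.SAWScalingLimit.Theses.SAWEdwardsStrongCoupling.CovarianceOfLimit := by
  dsimp only [Registered.stub_profileWindowLimit, Registered.stub_exactProfileCovariance,
    Registered.stub_profileUniversality, ProfileWindowLimit, ExactProfileCovariance,
    ProfileUniversality] at hPW hEC hPU
  intro Q P hQ hPch hPres hPsimple hQP D D' φ Φ h0 h1 hΦ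
  classical
  -- (PW): the profile window limits `R g` on `D'`, `g > 0`
  choose! R hR using fun g (hg : 0 < g) => hPW Q hQ g hg D D' φ h0 h1
  -- (EC): each is the conformal image of the homogeneous window limit on `D`
  have hRid : ∀ g : ℝ, 0 < g → R g = (Q g D).map (CurveClass.map Φ) :=
    fun g hg => hEC Q hQ g hg D D' φ Φ h0 h1 hΦ (R g) (hR g hg)
  -- (PU): and they converge to `P D'` as `g → ∞`
  have hRlim : ∀ f : CurveClass ℂ →ᵇ ℝ,
      Tendsto (fun g : ℝ => ∫ x, f x ∂(R g)) atTop (𝓝 (∫ x, f x ∂(P D'))) :=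
    hPU Q P hQ hPch hPres hPsimple hQP D D' φ h0 h1 R hR
  -- the image side: an endpoint approximation of `D`, measurability/continuity of `Φ_*`
  obtain ⟨a, b, hab⟩ := SAW.exists_isEndpointApprox D
  have hmeas : Measurable (CurveClass.map Φ) := CurveClass.measurable_map Φ
  haveI hPD' : IsProbabilityMeasure (P D') := (hPch D').1
  haveI hPD : IsProbabilityMeasure (P D) := (hPch D).1
  haveI : IsProbabilityMeasure ((P D).map (CurveClass.map Φ)) :=
    Measure.isProbabilityMeasure_map hmeas.aemeasurable
  refine ext_of_forall_integral_eq_of_IsFiniteMeasure fun f => ?_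
  -- `f ∘ Φ_*` as a bounded continuous test function
  let fΦ : CurveClass ℂ →ᵇ ℝ := f.compContinuous ⟨CurveClass.map Φ, CurveClass.continuous_map Φ⟩
  have hint : ∀ μ : Measure (CurveClass ℂ),
      ∫ x, f x ∂(μ.map (CurveClass.map Φ)) = ∫ x, fΦ x ∂μ := by
    intro μ
    rw [integral_map hmeas.aemeasurable f.continuous.aestronglyMeasurable]
    rfl
  have h1 : Tendsto (fun g : ℝ => ∫ x, fΦ x ∂(Q g D)) atTop (𝓝 (∫ x, fΦ x ∂(P D))) :=
    hQP D a b hab fΦ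
  have h3 : Tendsto (fun g : ℝ => ∫ x, f x ∂(R g)) atTop (𝓝 (∫ x, fΦ x ∂(P D))) := by
    refine h1.congr' ?_
    filter_upwards [eventually_gt_atTop (0 : ℝ)] with g hg
    rw [hRid g hg, hint]
  have h4 : ∫ x, f x ∂(P D') = ∫ x, fΦ x ∂(P D) := tendsto_nhds_unique (hRlim f) h3
  rw [h4, hint]

/-- **The crux proof modulo the stubs** (wiring check: the three stubs, exactly as stated over tree
vocabulary, feed the skeleton theorem; this term becomes the crux proof when the last `sorry` above is
discharged — it has no `sorry` of its own). -/
theorem CovarianceOfLimit_proof :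
    Summit.CriticalPhenomena.SAWScalingLimit.Theses.SAWEdwardsStrongCoupling.CovarianceOfLimit :=
  CovarianceOfLimit_of stub_profileWindowLimit stub_exactProfileCovariance stub_profileUniversality

end Summit.CriticalPhenomena.SAWScalingLimit.Cruxes.CovarianceOfLimit.Birth
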